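import Summits.AnomalousDissipation.AnomalousDissipation.Theses.MirrorVariety
import Literature.Analysis.FluidPDE.SteadyGalerkinApprox
import Literature.Analysis.FunctionSpaces.TorusFourierCalculus

/-!
# Line `depth-dichotomy-lanford` — crux `MirrorVariety.TaylorGreenLoudGalerkinStates` (stmt-AnomalousDissipation-2987)

Skeleton (crux-plan, round 1). Idea card `depth-dichotomy-lanford` (crux-ideate r1, ideator 1):
*generation index as time* — along the scale axis `n = log₂|k|` a steady Taylor–Green cascade is an
ORBIT of the exact depth recurrence `Π_n − Π_{n+1} = ν·D_n` (flux into generations `≥ n` minus flux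
into generations `≥ n+1` = viscous leak of generation `n`), `ν`-uniformity of energy and flux is the
statement that the orbit shadows a hyperbolic fixed point of the depth map (exponential dichotomy:
forcing end at generation `0`, viscous end at depth `≍ log(1/ν)`), and nondegeneracy of the steady
states is harvested for ALL large resolutions `N` by a Brezzi–Rappaz–Raviart / radii-polynomial
a-posteriori lift. The fixed point itself lives on the continuum scale-invariant problem (the lattice
`2^{-n}ℤ³` refines with depth) and is NOT typed; what is typed is finite-dimensional and exact:

* `stub_depthRecurrence` — the exact recurrence for steady Galerkin states of the generation-0 TG force
  (`ν · enstrophyAbove n c = flux n c`, `n ≥ 1`);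
* `stub_cascadeOrbit` — THE HEART: in arbitrarily small viscosity windows, well-resolved exact steady
  Galerkin TG states with `ν`-uniform energy bound and `ν`-uniform flux floor through every inertial
  generation `4ⁿν ≤ 1` (the constant-flux orbit);
* `stub_genericHyperbolicity` — off a countable set of viscosities, bounded steady Galerkin TG states are
  `h¹ → h⁻¹` nondegenerate uniformly in the resolution (Palmer/BRR bridge);
* `stub_aPosterioriLift` — a nondegenerate, well-resolved steady Galerkin state at resolution `N` has
  steady Galerkin states at every `N' ≥ N`, `κ`-close in energy and dissipation (discrete BRR).

Composition (sorry-free): `loudStates_of` (coefficient level), `fieldWitness_of_isSteady`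
(coefficients → the crux's tested form, Parseval), `TaylorGreenLoudGalerkinStates_of` (concludes the
crux BY NAME).
-/

noncomputable section

open MeasureTheory Filter Topology Set UnitAddTorus
open scoped InnerProductSpace Classical

namespace Summit.AnomalousDissipation.AnomalousDissipation.Cruxes.TaylorGreenLoudGalerkinStates.DepthDichotomyLanford

-- the crux-workfile namespace `Summit.<Summit>.<Sub>.Cruxes.…` repeats `AnomalousDissipation` (Sub = Summit)
set_option linter.dupNamespace false

open Literature.Analysis.FunctionSpaces Literature.Analysis.FunctionSpaces.Torus
open Literature.Analysis.FluidPDE Literature.Analysis.FluidPDE.Torus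
open Summit.AnomalousDissipation.AnomalousDissipation.Theses.MirrorVariety (TaylorGreenLoudGalerkinStates)

/-- The flat unit three-torus (local notation). -/
local notation "𝕋³" => UnitAddTorus (Fin 3)
/-- Velocity values (local notation). -/
local notation "E³" => EuclideanSpace ℝ (Fin 3)
/-- Complex coefficient values (local notation). -/
local notation "ℂ³" => EuclideanSpace ℂ (Fin 3)
/-- The frequency lattice (local notation). -/
local notation "ℤ³" => (Fin 3 → ℤ)

/-! ## The objects: TG force, resolution-`N` steady Galerkin states, generation functionals -/

/-- The punctured frequency ball `0 < |k|² ≤ N²` indexing the Galerkin unknowns at resolution `N`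
(verbatim the crux's `(freqBall N).erase 0`). -/
abbrev modes (N : ℕ) : Finset ℤ³ := (freqBall N).erase 0

/-- The Taylor–Green force `f_TG = (sin 2πx₀ cos 2πx₁ cos 2πx₂, −cos 2πx₀ sin 2πx₁ cos 2πx₂, 0)`,
verbatim the field of the crux (Fourier support `{±1}³`, the shell `|k|² = 3`, generation `0`). -/
def tgForce : 𝕋³ → E³ := fun x =>
  !₂[(fourier 1 (x 0) : ℂ).im * (fourier 1 (x 1) : ℂ).re * (fourier 1 (x 2) : ℂ).re,
    -((fourier 1 (x 0) : ℂ).re * (fourier 1 (x 1) : ℂ).im * (fourier 1 (x 2) : ℂ).re), (0 : ℝ)]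

/-- The Galerkin force vector of `f_TG` at resolution `N`: its Fourier coefficients on `modes N`. -/
def tgCoeff (N : ℕ) : ↥(modes N) → ℂ³ :=
  fun k => mFourierCoeff (EuclideanSpace.complexify ∘ tgForce) (k : ℤ³)

/-- **Steady Galerkin state** of the TG-forced Navier–Stokes equations at resolution `N` and viscosity
`ν`: a real solenoidal coefficient vector on `modes N` annihilated by the Fourier–Galerkin field
(`galerkinRHS`, the route's own object in `LaminarNeverLoud` / `MirrorDisconnection`). -/
def IsSteady (N : ℕ) (ν : ℝ) (c : ↥(modes N) → ℂ³) : Prop :=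
  c ∈ galerkinSubspace (modes N) ∧ galerkinRHS (modes N) ν (tgCoeff N) c = 0

/-- Energy `∑_k ‖c_k‖²` (`= ∫ |U|²` by Parseval). -/
def energy {N : ℕ} (c : ↥(modes N) → ℂ³) : ℝ := ∑ k : ↥(modes N), ‖c k‖ ^ 2

/-- Enstrophy `4π² ∑_k |k|² ‖c_k‖²` (`= ‖∇U‖²`, so the dissipation is `ν · enstrophy c`). -/
def enstrophy {N : ℕ} (c : ↥(modes N) → ℂ³) : ℝ :=
  4 * Real.pi ^ 2 * ∑ k : ↥(modes N), freqNormSq (k : ℤ³) * ‖c k‖ ^ 2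

/-- Enstrophy carried by the generations `≥ n`, i.e. by the modes `|k| ≥ 2ⁿ` (`4ⁿ ≤ |k|²`). -/
def enstrophyAbove {N : ℕ} (n : ℕ) (c : ↥(modes N) → ℂ³) : ℝ :=
  4 * Real.pi ^ 2 *
    ∑ k : ↥(modes N), if (4 : ℝ) ^ n ≤ freqNormSq (k : ℤ³) then freqNormSq (k : ℤ³) * ‖c k‖ ^ 2 else 0

/-- **Energy flux into the generations `≥ n`**: `Π_n(c) = −∑_{4ⁿ ≤ |k|²} Re ⟪B̂(c,c)_k, c_k⟫`, the rate
at which the (exact, all-triad) nonlinearity feeds the modes `|k| ≥ 2ⁿ` — the orbit coordinate of the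
depth recurrence. -/
def flux {N : ℕ} (n : ℕ) (c : ↥(modes N) → ℂ³) : ℝ :=
  -∑ k : ↥(modes N), if (4 : ℝ) ^ n ≤ freqNormSq (k : ℤ³) then
      (inner ℂ (convectionCoeff (modes N) (coeffExt (modes N) c) (coeffExt (modes N) c) (k : ℤ³))
        (c k)).re
    else 0

/-- A Wiener-type coefficient norm `∑_k (1 + |k|²) ‖c_k‖`, dominating `‖U‖_∞ + ‖∇U‖_∞ / 2π` of the
field `U = realTrigPoly (modes N) c̄` (the size entering the resolution threshold of the lift). -/
def wienerNorm {N : ℕ} (c : ↥(modes N) → ℂ³) : ℝ :=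
  ∑ k : ↥(modes N), (1 + freqNormSq (k : ℤ³)) * ‖c k‖

/-- **Unresolved nonlinear output** of a resolution-`N` state: the squared `ℓ²` size of the
Leray-projected modes of `B(U,U)` beyond the ball (all of them lie in `modes (2N)`); this is exactly
the residual of the zero-extension of a steady state in every finer Galerkin system. -/
def tailSq (N : ℕ) (c : ↥(modes N) → ℂ³) : ℝ :=
  ∑ k ∈ modes (2 * N) \ modes N,
    ‖leraySym k (convectionCoeff (modes N) (coeffExt (modes N) c) (coeffExt (modes N) c) k)‖ ^ 2

/-- The discrete `h⁻¹` size `∑_k ‖w_k‖² / (4π²|k|²)` of a coefficient vector (`|k| ≥ 1` on `modes N`). -/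
def hNegOneSq {N : ℕ} (w : ↥(modes N) → ℂ³) : ℝ :=
  ∑ k : ↥(modes N), ‖w k‖ ^ 2 / (4 * Real.pi ^ 2 * freqNormSq (k : ℤ³))

/-- **Nondegeneracy with constant `M`** of a state `c` at `(N, ν)`: the linearised steady Galerkin
operator `D_c F`, `F = galerkinRHS (modes N) ν (tgCoeff N)`, satisfies the scale-invariant lower bound
`ν ‖v‖_{h¹} ≤ M ‖D_c F v‖_{h⁻¹}` on the Galerkin phase space (`M = 1` for the Stokes operator; this is
`‖(I + (νA)⁻¹ Π DB(c))⁻¹‖_{h¹→h¹} ≤ M`, the form Brezzi–Rappaz–Raviart consume). -/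
def IsNondegenerate (N : ℕ) (ν : ℝ) (c : ↥(modes N) → ℂ³) (M : ℝ) : Prop :=
  ∀ v ∈ galerkinSubspace (modes N),
    ν ^ 2 * enstrophy v ≤ M ^ 2 * hNegOneSq (fderiv ℝ (galerkinRHS (modes N) ν (tgCoeff N)) c v)

/-! ## The four stub statements -/

/-- Statement of `stub_depthRecurrence` — **the exact depth recurrence** (no closure, no remainder
term other than the signed viscous leak): for every steady Galerkin state of the TG force and every
generation `n ≥ 1`, the dissipation carried by the modes `|k| ≥ 2ⁿ` equals the energy flux into them,
`ν · enstrophyAbove n c = flux n c`; equivalently `flux n c − flux (n+1) c = ν ·(enstrophy of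
generation n) ≥ 0`. (Test the Galerkin equation with the high-pass part of `c` itself: the Leray
multiplier is self-adjoint on transversal vectors, the Stokes term is real, and `f̂_TG` vanishes off
`|k|² = 3 < 4ⁿ`.) -/
def DepthRecurrence : Prop :=
  ∀ (N n : ℕ) (ν : ℝ) (c : ↥(modes N) → ℂ³), 1 ≤ n → IsSteady N ν c →
    ν * enstrophyAbove n c = flux n c

/-- Statement of `stub_cascadeOrbit` — **THE HEART (constant-flux orbit of the depth recurrence)**:
there are `E` and `ε > 0` such that inside every viscosity window `(0, δ)` there is an open interval
of viscosities at each of which, for every tolerance `τ > 0` and beyond every resolution `N₀`, there is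
an exact steady Galerkin TG state with energy `≤ E`, energy flux `≥ ε` into the generations `≥ n` for
EVERY inertial generation `1 ≤ n`, `4ⁿν ≤ 1` (constant flux down to wavenumber `ν^{-1/2} ≪ k_d`), a
`ν`-dependent Wiener bound, and unresolved output `≤ τ`. Conjectural (the steady K41 cascade for TG);
numerically falsifiable depth by depth. -/
def CascadeOrbit : Prop :=
  ∃ E ε : ℝ, 0 < ε ∧ ∀ δ : ℝ, 0 < δ → ∃ a b : ℝ, 0 < a ∧ a < b ∧ b < δ ∧ ∀ ν ∈ Set.Ioo a b,
    ∃ A : ℝ, ∀ τ : ℝ, 0 < τ → ∀ N₀ : ℕ, ∃ N : ℕ, N₀ ≤ N ∧ ∃ c : ↥(modes N) → ℂ³,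
      IsSteady N ν c ∧ energy c ≤ E ∧
      (∀ n : ℕ, 1 ≤ n → (4 : ℝ) ^ n * ν ≤ 1 → ε ≤ flux n c) ∧
      wienerNorm c ≤ A ∧ tailSq N c ≤ τ

/-- Statement of `stub_genericHyperbolicity` — **the Palmer / Brezzi–Rappaz–Raviart bridge**: off a
countable set `Z` of viscosities, every steady Galerkin TG state of energy `≤ E` is nondegenerate with
a constant `M(ν, E)` independent of the resolution `N` (generic nondegeneracy of steady Navier–Stokes
solutions, Foias–Temam 1977 / Saut–Temam 1980, made uniform in `N` by Galerkin convergence at fixed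
`ν`). -/
def GenericHyperbolicity : Prop :=
  ∃ Z : Set ℝ, Z.Countable ∧ ∀ ν : ℝ, 0 < ν → ν ∉ Z → ∀ E : ℝ, ∃ M : ℝ, 0 < M ∧
    ∀ (N : ℕ) (c : ↥(modes N) → ℂ³), IsSteady N ν c → energy c ≤ E → IsNondegenerate N ν c M

/-- Statement of `stub_aPosterioriLift` — **discrete Brezzi–Rappaz–Raviart / radii polynomials**:
given `ν, E, A, M, κ > 0` there are a resolution threshold `N₁` and a tail tolerance `τ > 0` such that
every steady Galerkin TG state at a resolution `N ≥ N₁` with energy `≤ E`, Wiener bound `≤ A`,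
nondegeneracy constant `M` and unresolved output `≤ τ` is accompanied, at EVERY finer resolution
`N' ≥ N`, by a steady Galerkin TG state whose energy is at most `κ` larger and whose dissipation is at
most `κ` smaller (Newton–Kantorovich about the zero-extension: the linearisation stays invertible
with bound `2M` once `N ≳ M A / ν`, the residual is the unresolved output). -/
def APosterioriLift : Prop :=
  ∀ ν E A M κ : ℝ, 0 < ν → 0 < M → 0 < κ → ∃ (N₁ : ℕ) (τ : ℝ), 0 < τ ∧
    ∀ N : ℕ, N₁ ≤ N → ∀ c : ↥(modes N) → ℂ³, IsSteady N ν c → energy c ≤ E → wienerNorm c ≤ A →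
      IsNondegenerate N ν c M → tailSq N c ≤ τ →
      ∀ N' : ℕ, N ≤ N' → ∃ c' : ↥(modes N') → ℂ³,
        IsSteady N' ν c' ∧ energy c' ≤ energy c + κ ∧ ν * enstrophy c - κ ≤ ν * enstrophy c'

/-! ## Registered stubs -/

/-- STUB 1 (size M, true): the exact depth recurrence `ν · enstrophyAbove n c = flux n c` for steady
Galerkin states of the generation-0 force `f_TG` (finite-sum bookkeeping with `galerkinField_def`,
`inner_leraySym_left_of_transversal`, and the Fourier support `{±1}³` of `f_TG`). -/
theorem stub_depthRecurrence : DepthRecurrence := by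
  sorry

/-- STUB 2 (size XL, OPEN — the hardest): the constant-flux orbit. Proof architecture of the idea:
depth induction along `ν ↦ ν/16`, `N ↦ 8N` shadowing a hyperbolic fixed point of the K41-rescaled
depth map; certified at depths 1–3 by interval Newton (kit evidence). -/
theorem stub_cascadeOrbit : CascadeOrbit := by
  sorry

/-- STUB 3 (size XL, generic-true): uniform-in-`N` nondegeneracy of bounded steady Galerkin TG states off
a countable set of viscosities (real-algebraic discriminants at each `N` + BRR convergence at fixed `ν`). -/
theorem stub_genericHyperbolicity : GenericHyperbolicity := by
  sorry

/-- STUB 4 (size XL, true in print): the a-posteriori lift to all finer resolutions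
(Brezzi–Rappaz–Raviart 1980; van den Berg–Breden–Lessard–van Veen 2021 radii polynomials; tree:
`Literature/Analysis/Calculus/SimplifiedNewton.lean`). -/
theorem stub_aPosterioriLift : APosterioriLift := by
  sorry

/-! ## Composition, part 1: coefficient level -/

/-- The enstrophy above any generation is at most the total enstrophy. -/
theorem enstrophyAbove_le_enstrophy {N : ℕ} (n : ℕ) (c : ↥(modes N) → ℂ³) :
    enstrophyAbove n c ≤ enstrophy c := by
  unfold enstrophyAbove enstrophy
  refine mul_le_mul_of_nonneg_left (Finset.sum_le_sum fun k _ => ?_) (by positivity)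
  split_ifs
  · exact le_rfl
  · exact mul_nonneg (freqNormSq_nonneg _) (sq_nonneg _)

/-- A countable set of reals omits a point of every nondegenerate open interval. -/
theorem exists_mem_Ioo_not_mem_of_countable {Z : Set ℝ} (hZ : Z.Countable) {a b : ℝ} (hab : a < b) :
    ∃ x, x ∈ Set.Ioo a b ∧ x ∉ Z := by
  by_contra h
  push Not at h
  have hsub : Set.Ioo a b ⊆ Z := fun x hx => h x hx
  have h0 : (volume : Measure ℝ) (Set.Ioo a b) = 0 :=
    measure_mono_null hsub (hZ.measure_zero volume)
  rw [Real.volume_Ioo] at h0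
  have hpos : 0 < b - a := sub_pos.2 hab
  exact (ENNReal.ofReal_pos.2 hpos).ne' h0

/-- **Loud bounded steady Galerkin TG states at all large resolutions along a viscosity sequence**
(coefficient level), from the four stubs: pick `ν_j` in the `j`-th cascade window off the exceptional
countable set, take the nondegeneracy constant `M_j`, the lift thresholds `(N₁, τ)` for `κ = ε/2`, a
well-resolved orbit state beyond `max N₁ 2`, read its loudness off the depth recurrence at generation
`1`, and lift. -/
theorem loudStates_of (hR : DepthRecurrence) (hC : CascadeOrbit) (hH : GenericHyperbolicity)
    (hL : APosterioriLift) :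
    ∃ (ν : ℕ → ℝ) (E ε : ℝ), (∀ j, 0 < ν j) ∧ Tendsto ν atTop (𝓝 0) ∧ 0 < ε ∧
      ∀ j, ∀ᶠ N in atTop, ∃ c : ↥(modes N) → ℂ³,
        IsSteady N (ν j) c ∧ energy c ≤ E ∧ ε ≤ ν j * enstrophy c := by
  obtain ⟨E, ε, hε, hwin⟩ := hC
  obtain ⟨Z, hZ, hyp⟩ := hH
  -- the viscosity ladder: ν j in the j-th window, below 1/4 and 1/(j+1), off Z
  have hδ : ∀ j : ℕ, (0 : ℝ) < min (1 / 4) (1 / ((j : ℝ) + 1)) := fun j => by positivity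
  choose a b ha hab hb hstates using fun j : ℕ => hwin _ (hδ j)
  choose ν hνI hνZ using fun j : ℕ => exists_mem_Ioo_not_mem_of_countable hZ (hab j)
  have hνpos : ∀ j, 0 < ν j := fun j => (ha j).trans (hνI j).1
  have hνlt : ∀ j, ν j < min (1 / 4) (1 / ((j : ℝ) + 1)) := fun j => (hνI j).2.trans (hb j)
  refine ⟨ν, E + ε / 2, ε / 2, hνpos, ?_, by positivity, fun j => ?_⟩
  · refine squeeze_zero (fun j => (hνpos j).le)
      (fun j => ((hνlt j).le.trans (min_le_right _ _))) tendsto_one_div_add_atTop_nhds_zero_nat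
  · obtain ⟨A, hA⟩ := hstates j (ν j) (hνI j)
    obtain ⟨M, hM, hnd⟩ := hyp (ν j) (hνpos j) (hνZ j) E
    obtain ⟨N₁, τ, hτ, hlift⟩ := hL (ν j) E A M (ε / 2) (hνpos j) hM (by positivity)
    obtain ⟨N, hN, c, hst, hE, hflux, hW, htail⟩ := hA τ hτ (max N₁ 2)
    have hN₁ : N₁ ≤ N := (le_max_left _ _).trans hN
    have h4 : (4 : ℝ) ^ 1 * ν j ≤ 1 := by
      have := (hνlt j).le.trans (min_le_left _ _)
      rw [pow_one]
      linarith
    have hflux1 : ε ≤ flux 1 c := hflux 1 le_rfl h4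
    have hrec : ν j * enstrophyAbove 1 c = flux 1 c := hR N 1 (ν j) c le_rfl hst
    have hmono : ν j * enstrophyAbove 1 c ≤ ν j * enstrophy c :=
      mul_le_mul_of_nonneg_left (enstrophyAbove_le_enstrophy 1 c) (hνpos j).le
    have hloud : ε ≤ ν j * enstrophy c := by linarith
    filter_upwards [eventually_ge_atTop N] with N' hN'
    obtain ⟨c', hst', hE', hD'⟩ :=
      hlift N hN₁ c hst hE hW (hnd N c hst hE) htail N' hN'
    exact ⟨c', hst', by linarith, by linarith⟩

/-! ## Composition, part 2: coefficients → the crux's tested form -/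

/-- The TG force is continuous. -/
theorem continuous_tgForce : Continuous tgForce := by
  have h0 : ∀ i : Fin 3, Continuous fun x : 𝕋³ => (fourier 1 (x i) : ℂ) :=
    fun i => (fourier 1).continuous.comp (continuous_apply i)
  have hre : ∀ i : Fin 3, Continuous fun x : 𝕋³ => (fourier 1 (x i) : ℂ).re :=
    fun i => Complex.continuous_re.comp (h0 i)
  have him : ∀ i : Fin 3, Continuous fun x : 𝕋³ => (fourier 1 (x i) : ℂ).im :=
    fun i => Complex.continuous_im.comp (h0 i)
  unfold tgForce
  refine (PiLp.continuous_toLp 2 _).comp ?_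
  exact (((him 0).mul (hre 1)).mul (hre 2)).matrixVecCons
    ((((hre 0).mul (him 1)).mul (hre 2)).neg.matrixVecCons
      (continuous_const.matrixVecCons continuous_const))

/-- The TG force is square integrable. -/
theorem memLp_tgForce : MemLp tgForce 2 volume :=
  continuous_tgForce.memLp_of_hasCompactSupport (HasCompactSupport.of_compactSpace _)

/-- **From a steady Galerkin coefficient vector to the crux's field-level witness.** The real
trigonometric polynomial `U = realTrigPoly (modes N) c̄` of a steady state is smooth, divergence free,
mean zero, band-limited to `modes N`, solves the tested Galerkin equations against every band-limited
smooth divergence-free field with the literal force `f_TG` (master identity I + Parseval, as in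
`exists_steady_galerkin_approx`), and its energy / gradient norm are `energy c` / `enstrophy c`. -/
theorem fieldWitness_of_isSteady {N : ℕ} {ν : ℝ} {c : ↥(modes N) → ℂ³} (h : IsSteady N ν c) :
    (IsSmooth (realTrigPoly (modes N) (coeffExt (modes N) c)) ∧
      IsDivFree (realTrigPoly (modes N) (coeffExt (modes N) c)) ∧
      HasZeroMean (realTrigPoly (modes N) (coeffExt (modes N) c)) ∧
      (∀ k ∉ modes N,
        mFourierCoeff (EuclideanSpace.complexify ∘ realTrigPoly (modes N) (coeffExt (modes N) c)) k = 0) ∧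
      ∀ a : 𝕋³ → E³, IsSmooth a → IsDivFree a →
        (∀ k ∉ modes N, mFourierCoeff (EuclideanSpace.complexify ∘ a) k = 0) →
        ∫ x, (⟪realTrigPoly (modes N) (coeffExt (modes N) c) x,
              convect (realTrigPoly (modes N) (coeffExt (modes N) c)) a x⟫_ℝ +
            ν * ⟪realTrigPoly (modes N) (coeffExt (modes N) c) x, laplacian a x⟫_ℝ +
            ⟪tgForce x, a x⟫_ℝ) = 0) ∧
    ∫ x, ‖realTrigPoly (modes N) (coeffExt (modes N) c) x‖ ^ 2 = energy c ∧
    gradNormSq (realTrigPoly (modes N) (coeffExt (modes N) c)) = enstrophy c := by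
  have hS : ∀ k ∈ modes N, -k ∈ modes N := neg_mem_freqBall_erase_zero
  have hS0 : (0 : ℤ³) ∉ modes N := by simp [modes]
  obtain ⟨hc, h0⟩ := h
  have hCsymm : IsConjSymm (coeffExt (modes N) c) := hc.1.isConjSymm_coeffExt hS
  have hCT : IsTransversal (modes N) (coeffExt (modes N) c) := hc.2.isTransversal_coeffExt
  have hfi : Integrable tgForce volume := continuous_tgForce.integrable_unitAddTorus
  have hgr : IsRealCoeff (tgCoeff N) := isRealCoeff_mFourierCoeff hfi
  have hGg : realTrigPoly (modes N) (coeffExt (modes N) (tgCoeff N)) =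
      realTrigPoly (modes N) fun k => mFourierCoeff (EuclideanSpace.complexify ∘ tgForce) k :=
    realTrigPoly_coeffExt_restrict _
  have hu : IsSmooth (realTrigPoly (modes N) (coeffExt (modes N) c)) := isSmooth_realTrigPoly _ _
  refine ⟨⟨hu, isDivFree_realTrigPoly hCT, hasZeroMean_realTrigPoly_of_zero_not_mem hS0 _,
    fun k hk => mFourierCoeff_realTrigPoly_eq_zero hS hCsymm hk, ?_⟩, ?_, ?_⟩
  · -- the tested Galerkin equations with the literal force
    intro a ha hdiv hband
    have hid := sum_re_inner_galerkinField_test ν hS (hgr.isConjSymm_coeffExt hS) hCsymm hCT ha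
      hdiv hband
    have hzero : ∑ k ∈ modes N, (inner ℂ (galerkinField ν (modes N) (coeffExt (modes N) (tgCoeff N))
        (coeffExt (modes N) c) k) (mFourierCoeff (EuclideanSpace.complexify ∘ a) k)).re = 0 := by
      refine Finset.sum_eq_zero fun k hk => ?_
      have hk0 : galerkinField ν (modes N) (coeffExt (modes N) (tgCoeff N)) (coeffExt (modes N) c) k = 0 := by
        have := congrFun h0 ⟨k, hk⟩
        rwa [galerkinRHS_apply] at this
      rw [hk0, inner_zero_left, Complex.zero_re]
    rw [hzero, hGg] at hid
    have hGs : IsSmooth (realTrigPoly (modes N)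
        fun k => mFourierCoeff (EuclideanSpace.complexify ∘ tgForce) k) :=
      isSmooth_realTrigPoly _ _
    have i1 : Integrable (fun x => ⟪realTrigPoly (modes N) (coeffExt (modes N) c) x,
        convect (realTrigPoly (modes N) (coeffExt (modes N) c)) a x⟫_ℝ +
        ν * ⟪realTrigPoly (modes N) (coeffExt (modes N) c) x, laplacian a x⟫_ℝ) volume :=
      ((hu.continuous.inner (hu.convect ha).continuous).add
        ((hu.continuous.inner ha.laplacian.continuous).const_smul ν)).integrable_unitAddTorus
    have i2 : Integrable (fun x => ⟪realTrigPoly (modes N)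
        (fun k => mFourierCoeff (EuclideanSpace.complexify ∘ tgForce) k) x, a x⟫_ℝ) volume :=
      (hGs.continuous.inner ha.continuous).integrable_unitAddTorus
    have i3 : Integrable (fun x => ⟪tgForce x, a x⟫_ℝ) volume :=
      integrable_inner_of_continuous hfi ha.continuous
    have hforce := integral_inner_realTrigPoly_mFourierCoeff_eq hS memLp_tgForce
      (ha.continuous.memLp_of_hasCompactSupport (HasCompactSupport.of_compactSpace _)) hband
    rw [integral_add i1 i2, hforce, ← integral_add i1 i3] at hid
    exact hid.symm
  · -- energy (finite Parseval)
    show _ = ∑ k : ↥(modes N), ‖c k‖ ^ 2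
    rw [integral_norm_sq_realTrigPoly hS hCsymm, ← sum_coeffExt (fun _ v => ‖v‖ ^ 2) c]
  · -- gradient norm (spectral form)
    show _ = 4 * Real.pi ^ 2 * ∑ k : ↥(modes N), freqNormSq (k : ℤ³) * ‖c k‖ ^ 2
    rw [gradNormSq_eq_toReal_eGradNormSq_holds hu, toReal_eGradNormSq_realTrigPoly hS hCsymm,
      ← sum_coeffExt (fun k v => freqNormSq k * ‖v‖ ^ 2) c]

/-! ## Composition, part 3: the skeleton concludes the crux BY NAME -/

/-- **Composition of the line.** The four stub statements imply
`MirrorVariety.TaylorGreenLoudGalerkinStates` (stmt-AnomalousDissipation-2987). -/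
theorem TaylorGreenLoudGalerkinStates_of :
    DepthRecurrence → CascadeOrbit → GenericHyperbolicity → APosterioriLift →
      TaylorGreenLoudGalerkinStates := by
  intro hR hC hH hL f hf
  subst hf
  obtain ⟨ν, E, ε, hν, hν0, hε, hj⟩ := loudStates_of hR hC hH hL
  refine ⟨ν, E, ε, hν, hν0, hε, fun j => ?_⟩
  filter_upwards [hj j] with N hN
  obtain ⟨c, hst, hE, hD⟩ := hN
  obtain ⟨h1, h2, h3⟩ := fieldWitness_of_isSteady hst
  refine ⟨realTrigPoly (modes N) (coeffExt (modes N) c), h1, ?_, ?_⟩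
  · rw [h2]; exact hE
  · rw [h3]; exact hD

/-- The crux from the registered stubs (audited by name). -/
theorem TaylorGreenLoudGalerkinStates_holds_of_stubs : TaylorGreenLoudGalerkinStates :=
  TaylorGreenLoudGalerkinStates_of stub_depthRecurrence stub_cascadeOrbit stub_genericHyperbolicity
    stub_aPosterioriLift

end Summit.AnomalousDissipation.AnomalousDissipation.Cruxes.TaylorGreenLoudGalerkinStates.DepthDichotomyLanford

end
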